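import Summits.QuantumFields.BalabanUV.T4Continuum.Support.NE7LatticeHodgeGradient
import HarnessLib

/-!
# NE7 — THE CELL-CENTRED REFLECTION DOUBLING OF A BOX, I: the `2M`-periodic zigzag fold `ℤ → [0, M)`, the fold `Φ : ℤᵈ → lo + [0, M)ᵈ`, and
# the pullback `Ã` of a box bond field along it — `2M`-periodic, equal to `A` on the box, zero on the bonds straddling a mirror, bounded by
# `sup_box ‖A‖`, commuting with odd bond maps (F308a; def-free: the fold, `Φ` and `Ã` enter through their defining equations as hypotheses)

Cell `pub-balaban`, rung (B)+1 sub-cell t4, lineage `b2b-balaban-t4-ne7-p1` (CRUX PROVER NE7 #1 = OWNER of row NE7), generation 93; memo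
`t4/b2b-balaban-t4-ne7-p1-g93/UHLENBECK-ROAD.md` §1.  First brick of road (U-CM): the a priori sup estimate of a free-boundary lattice Landau
gauge on a box is proved on the DOUBLED TORUS, where the free-boundary (Neumann) Euler–Lagrange condition becomes the exact torus Landau
condition and the period-`2M` sup-regularity of the lattice Laplacian (`NE3DiscreteGradientEstimate.supRegularity_of_blockMeanZero`) applies.

WHY CELL-CENTRED.  Reflecting about the SITE hyperplanes doubles the normal bond term of the divergence at a face site; reflecting about the
hyperplanes `x_μ = lo_μ − ½`, `x_μ = lo_μ + M − ½` (period `2M`, mirrors between sites) makes the two bonds straddling a mirror self-mirror,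
hence `0` (odd normal component), and the torus divergence at every site equals the free-boundary divergence at its fold (F308b) — no factor 2.

WHAT ([folklore] lattice bookkeeping; 0 def — the zigzag `f`, the fold `Φ` and the pullback `Ã` are variables constrained by their defining
equations `hf`, `hΦ`, `hÃ`; F308b instantiates them; 0 sorry):
* §1 `fold_nonneg`, `fold_lt`, `fold_add_period`, `fold_of_mem`, `fold_step` (the four local shapes of the zigzag), `fold_triple` (the six shapes
  of two consecutive steps, `M ≥ 2`).
* §2 `foldPt_mem`, `foldPt_of_mem`, `foldPt_add_e`, `foldPt_sub_e`, `foldPt_add_period`, `step_cases`, `step_of_mem`.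
* §3 `pull_periodic`, `pull_eq_self` (on box bonds), `pull_face_eq_zero` (straddling bonds), `pull_map_odd`, `norm_pull_le`.
HONEST FRAMING (page 1): pure lattice combinatorics on `ℤᵈ`; nothing of Bałaban's asserted; NE7 NOT PROVED here; spine 0∕9; finite T⁴ rung (B)+1 —
NOT infinite volume, NOT mass gap, NOT `BetaPertH`, NOT Clay.  No `sorry`; axioms ⊆ {propext, Classical.choice, Quot.sound}.
-/

set_option autoImplicit false

open scoped BigOperators
open Finset

namespace Summit.QuantumFields.BalabanUV.T4Continuum.NE7BoxReflection

open Literature.MathematicalPhysics.QuantumFieldTheory.Balaban1983to89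
open B7Prop1Explicit

variable {d : ℕ}

/-! ## §0 Coordinates of lattice neighbours -/

/-- Coordinates of `x + e_μ`: the others do not move. [folklore] -/
theorem add_e_apply_ne (x : Site d) {μ i : Fin d} (h : i ≠ μ) : (x + e μ) i = x i := by
  simp [e_apply, h]

/-- Coordinates of `x − e_μ`: the others do not move. [folklore] -/
theorem sub_e_apply_ne (x : Site d) {μ i : Fin d} (h : i ≠ μ) : (x - e μ) i = x i := by
  simp [e_apply, h]

/-- Coordinates of `x + T·e_τ`: the `τ`-th moves by `T`. [folklore] -/
theorem add_zsmul_e_apply_self (x : Site d) (τ : Fin d) (T : ℤ) : (x + T • e τ) τ = x τ + T := by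
  simp [e_apply]

/-- Coordinates of `x + T·e_τ`: the others do not move. [folklore] -/
theorem add_zsmul_e_apply_ne (x : Site d) {τ i : Fin d} (h : i ≠ τ) (T : ℤ) : (x + T • e τ) i = x i := by
  simp [e_apply, h]

/-! ## §1 The one-dimensional zigzag fold of period `2M` onto `[0, M)` -/

section Fold

variable {M : ℕ} {f : ℤ → ℤ}
  (hf : ∀ c : ℤ, f c = if c % (2 * (M : ℤ)) < M then c % (2 * (M : ℤ)) else 2 * M - 1 - c % (2 * (M : ℤ)))
include hf

/-- The zigzag fold takes values `≥ 0` (`M ≥ 1`). [folklore] -/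
theorem fold_nonneg (hM : 1 ≤ M) (c : ℤ) : 0 ≤ f c := by
  have h1M : (1 : ℤ) ≤ M := by exact_mod_cast hM
  have hT : (0 : ℤ) < 2 * (M : ℤ) := by linarith
  have h0 : 0 ≤ c % (2 * (M : ℤ)) := Int.emod_nonneg _ hT.ne'
  have h1 : c % (2 * (M : ℤ)) < 2 * (M : ℤ) := Int.emod_lt_of_pos _ hT
  rw [hf]; split_ifs <;> omega

/-- The zigzag fold takes values `< M` (`M ≥ 1`). [folklore] -/
theorem fold_lt (hM : 1 ≤ M) (c : ℤ) : f c < M := by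
  have h1M : (1 : ℤ) ≤ M := by exact_mod_cast hM
  have hT : (0 : ℤ) < 2 * (M : ℤ) := by linarith
  have h0 : 0 ≤ c % (2 * (M : ℤ)) := Int.emod_nonneg _ hT.ne'
  have h1 : c % (2 * (M : ℤ)) < 2 * (M : ℤ) := Int.emod_lt_of_pos _ hT
  rw [hf]; split_ifs <;> omega

/-- The zigzag fold is `2M`-periodic. [folklore] -/
theorem fold_add_period (c : ℤ) : f (c + 2 * (M : ℤ)) = f c := by
  rw [hf, hf c, show c + 2 * (M : ℤ) = c + (2 * (M : ℤ)) * 1 by ring, Int.add_mul_emod_self_left]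

/-- On `[0, M)` the zigzag fold is the identity. [folklore] -/
theorem fold_of_mem {c : ℤ} (h0 : 0 ≤ c) (h1 : c < M) : f c = c := by
  have hc : c % (2 * (M : ℤ)) = c := Int.emod_eq_of_lt h0 (by linarith)
  rw [hf, hc, if_pos h1]

/-- **THE FOUR LOCAL SHAPES OF THE ZIGZAG** (`M ≥ 1`): one step of the fold is `+1` (ascending), `0` at the top mirror (value `M − 1`), `−1`
(descending) or `0` at the bottom mirror (value `0`), according to `c mod 2M`. [folklore] -/
theorem fold_step (hM : 1 ≤ M) (c : ℤ) :
    (c % (2 * (M : ℤ)) < M - 1 ∧ f (c + 1) = f c + 1) ∨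
    (c % (2 * (M : ℤ)) = M - 1 ∧ f (c + 1) = f c ∧ f c = M - 1) ∨
    ((M : ℤ) ≤ c % (2 * (M : ℤ)) ∧ c % (2 * (M : ℤ)) < 2 * M - 1 ∧ f (c + 1) = f c - 1) ∨
    (c % (2 * (M : ℤ)) = 2 * M - 1 ∧ f (c + 1) = f c ∧ f c = 0) := by
  have hM' : (1 : ℤ) ≤ M := by exact_mod_cast hM
  have hT : (0 : ℤ) < 2 * (M : ℤ) := by linarith
  have h0 : 0 ≤ c % (2 * (M : ℤ)) := Int.emod_nonneg _ hT.ne'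
  have h1 : c % (2 * (M : ℤ)) < 2 * (M : ℤ) := Int.emod_lt_of_pos _ hT
  -- the successor under `emod`
  have hs : (c + 1) % (2 * (M : ℤ)) = if c % (2 * (M : ℤ)) = 2 * (M : ℤ) - 1 then 0 else c % (2 * (M : ℤ)) + 1 := by
    have hc : c + 1 = (c % (2 * (M : ℤ)) + 1) + (2 * (M : ℤ)) * (c / (2 * (M : ℤ))) := by
      have := Int.emod_add_ediv_mul c (2 * (M : ℤ)); linarith
    rw [hc, Int.add_mul_emod_self_left]
    split_ifs with h
    · rw [h, sub_add_cancel, Int.emod_self]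
    · exact Int.emod_eq_of_lt (by linarith) (by omega)
  rw [hf (c + 1), hf c, hs]
  generalize c % (2 * (M : ℤ)) = r at h0 h1 ⊢
  by_cases hr1 : r < M - 1
  · exact Or.inl ⟨hr1, by split_ifs <;> omega⟩
  by_cases hr2 : r = M - 1
  · exact Or.inr (Or.inl ⟨hr2, by split_ifs <;> omega, by split_ifs <;> omega⟩)
  by_cases hr3 : r < 2 * M - 1
  · exact Or.inr (Or.inr (Or.inl ⟨by omega, hr3, by split_ifs <;> omega⟩))
  · exact Or.inr (Or.inr (Or.inr ⟨by omega, by split_ifs <;> omega, by split_ifs <;> omega⟩))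

/-- **THE SIX SHAPES OF TWO CONSECUTIVE STEPS** (`M ≥ 2`), with `δ′ = f c − f(c−1)`, `δ = f(c+1) − f c`: ascending interior, bottom corner entered
from the mirror, top corner left into the flat, top corner entered from the flat, descending interior, bottom corner left into the flat — together
with the value of `f c` at the corners. [folklore] -/
theorem fold_triple (hM : 2 ≤ M) (c : ℤ) :
    (f c - f (c - 1) = 1 ∧ f (c + 1) - f c = 1 ∧ 1 ≤ f c ∧ f c ≤ M - 2) ∨
    (f c - f (c - 1) = 0 ∧ f (c + 1) - f c = 1 ∧ f c = 0) ∨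
    (f c - f (c - 1) = 1 ∧ f (c + 1) - f c = 0 ∧ f c = M - 1) ∨
    (f c - f (c - 1) = 0 ∧ f (c + 1) - f c = -1 ∧ f c = M - 1) ∨
    (f c - f (c - 1) = -1 ∧ f (c + 1) - f c = -1 ∧ 1 ≤ f c ∧ f c ≤ M - 2) ∨
    (f c - f (c - 1) = -1 ∧ f (c + 1) - f c = 0 ∧ f c = 0) := by
  have hM' : (2 : ℤ) ≤ M := by exact_mod_cast hM
  have hT : (0 : ℤ) < 2 * (M : ℤ) := by linarith
  have h0 : 0 ≤ c % (2 * (M : ℤ)) := Int.emod_nonneg _ hT.ne'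
  have h1 : c % (2 * (M : ℤ)) < 2 * (M : ℤ) := Int.emod_lt_of_pos _ hT
  have hsucc : ∀ b : ℤ, (b + 1) % (2 * (M : ℤ)) = if b % (2 * (M : ℤ)) = 2 * (M : ℤ) - 1 then 0 else b % (2 * (M : ℤ)) + 1 := by
    intro b
    have hb0 : 0 ≤ b % (2 * (M : ℤ)) := Int.emod_nonneg _ hT.ne'
    have hb1 : b % (2 * (M : ℤ)) < 2 * (M : ℤ) := Int.emod_lt_of_pos _ hT
    have hc : b + 1 = (b % (2 * (M : ℤ)) + 1) + (2 * (M : ℤ)) * (b / (2 * (M : ℤ))) := by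
      have := Int.emod_add_ediv_mul b (2 * (M : ℤ)); linarith
    rw [hc, Int.add_mul_emod_self_left]
    split_ifs with h
    · rw [h, sub_add_cancel, Int.emod_self]
    · exact Int.emod_eq_of_lt (by linarith) (by omega)
  have hs := hsucc c
  -- the predecessor under `emod`
  have hp : (c - 1) % (2 * (M : ℤ)) = if c % (2 * (M : ℤ)) = 0 then 2 * (M : ℤ) - 1 else c % (2 * (M : ℤ)) - 1 := by
    have h := hsucc (c - 1)
    rw [sub_add_cancel] at h
    have hq0 : 0 ≤ (c - 1) % (2 * (M : ℤ)) := Int.emod_nonneg _ hT.ne'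
    have hq1 : (c - 1) % (2 * (M : ℤ)) < 2 * (M : ℤ) := Int.emod_lt_of_pos _ hT
    by_cases hc : (c - 1) % (2 * (M : ℤ)) = 2 * (M : ℤ) - 1
    · rw [if_pos hc] at h; rw [if_pos h, hc]
    · rw [if_neg hc] at h; rw [h, if_neg (by omega)]; ring
  rw [hf (c + 1), hf c, hf (c - 1), hs, hp]
  generalize c % (2 * (M : ℤ)) = r at h0 h1 ⊢
  by_cases hr0 : r = 0
  · exact Or.inr (Or.inl ⟨by split_ifs <;> omega, by split_ifs <;> omega, by split_ifs <;> omega⟩)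
  by_cases hr1 : r < M - 1
  · exact Or.inl ⟨by split_ifs <;> omega, by split_ifs <;> omega, by split_ifs <;> omega, by split_ifs <;> omega⟩
  by_cases hr2 : r = M - 1
  · exact Or.inr (Or.inr (Or.inl ⟨by split_ifs <;> omega, by split_ifs <;> omega, by split_ifs <;> omega⟩))
  by_cases hr3 : r = M
  · exact Or.inr (Or.inr (Or.inr (Or.inl ⟨by split_ifs <;> omega, by split_ifs <;> omega, by split_ifs <;> omega⟩)))
  by_cases hr4 : r < 2 * M - 1
  · exact Or.inr (Or.inr (Or.inr (Or.inr (Or.inl ⟨by split_ifs <;> omega, by split_ifs <;> omega, by split_ifs <;> omega,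
      by split_ifs <;> omega⟩))))
  · exact Or.inr (Or.inr (Or.inr (Or.inr (Or.inr ⟨by split_ifs <;> omega, by split_ifs <;> omega, by split_ifs <;> omega⟩))))

/-! ## §2 The fold `Φ` of `ℤᵈ` onto the box `lo + [0, M)ᵈ` -/

variable {lo : Site d} {Φ : Site d → Site d} (hΦ : ∀ (x : Site d) (i : Fin d), Φ x i = lo i + f (x i - lo i))
include hΦ

/-- The fold lands in the box (`M ≥ 1`). [folklore] -/
theorem foldPt_mem (hM : 1 ≤ M) (x : Site d) (i : Fin d) : lo i ≤ Φ x i ∧ Φ x i < lo i + M := by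
  rw [hΦ]; exact ⟨by linarith [fold_nonneg hf hM (x i - lo i)], by linarith [fold_lt hf hM (x i - lo i)]⟩

/-- The fold is the identity on the box. [folklore] -/
theorem foldPt_of_mem {x : Site d} (hx : ∀ i, lo i ≤ x i ∧ x i < lo i + M) : Φ x = x := by
  funext i
  have h := hx i
  rw [hΦ, fold_of_mem hf (by linarith) (by linarith)]; ring

omit hf in
/-- **THE FOLD ALONG A BOND**: `Φ(x + e_μ) = Φ(x) + (f(x_μ + 1 − lo_μ) − f(x_μ − lo_μ))·e_μ`. [folklore] -/
theorem foldPt_add_e (x : Site d) (μ : Fin d) : Φ (x + e μ) = Φ x + (f (x μ + 1 - lo μ) - f (x μ - lo μ)) • e μ := by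
  funext i
  by_cases hi : i = μ
  · subst hi
    rw [add_zsmul_e_apply_self, hΦ, hΦ, show (x + e i) i = x i + 1 by simp [e_apply]]; ring
  · rw [add_zsmul_e_apply_ne _ hi, hΦ, hΦ, add_e_apply_ne x hi]

omit hf in
/-- `Φ(x − e_μ) = Φ(x) − (f(x_μ − lo_μ) − f(x_μ − 1 − lo_μ))·e_μ`. [folklore] -/
theorem foldPt_sub_e (x : Site d) (μ : Fin d) : Φ (x - e μ) = Φ x - (f (x μ - lo μ) - f (x μ - 1 - lo μ)) • e μ := by
  have h := foldPt_add_e hΦ (x - e μ) μ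
  rw [sub_add_cancel, show (x - e μ) μ = x μ - 1 by simp [e_apply], show x μ - 1 + 1 - lo μ = x μ - lo μ by ring] at h
  rw [h]; abel

/-- The fold is `2M`-periodic. [folklore] -/
theorem foldPt_add_period (x : Site d) (τ : Fin d) : Φ (x + ((2 * M : ℕ) : ℤ) • e τ) = Φ x := by
  funext i
  rw [hΦ, hΦ]
  by_cases hi : i = τ
  · subst hi
    rw [add_zsmul_e_apply_self, show x i + ((2 * M : ℕ) : ℤ) - lo i = (x i - lo i) + 2 * (M : ℤ) by push_cast; ring, fold_add_period hf]
  · rw [add_zsmul_e_apply_ne x hi]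

omit hΦ in
/-- The step of the fold along a bond is `1`, `−1` or `0` (`M ≥ 1`). [folklore] -/
theorem step_cases (hM : 1 ≤ M) (x : Site d) (μ : Fin d) :
    f (x μ + 1 - lo μ) - f (x μ - lo μ) = 1 ∨ f (x μ + 1 - lo μ) - f (x μ - lo μ) = -1 ∨ f (x μ + 1 - lo μ) - f (x μ - lo μ) = 0 := by
  rw [show x μ + 1 - lo μ = (x μ - lo μ) + 1 by ring]
  rcases fold_step hf hM (x μ - lo μ) with ⟨-, h⟩ | ⟨-, h, -⟩ | ⟨-, -, h⟩ | ⟨-, h, -⟩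
  · exact Or.inl (by rw [h]; ring)
  · exact Or.inr (Or.inr (by rw [h]; ring))
  · exact Or.inr (Or.inl (by rw [h]; ring))
  · exact Or.inr (Or.inr (by rw [h]; ring))

omit hΦ in
/-- On a box bond the step is `+1`. [folklore] -/
theorem step_of_mem {x : Site d} {μ : Fin d} (hx : ∀ i, lo i ≤ x i ∧ x i < lo i + M) (hxμ : ∀ i, lo i ≤ (x + e μ) i ∧ (x + e μ) i < lo i + M) :
    f (x μ + 1 - lo μ) - f (x μ - lo μ) = 1 := by
  have h1 := hx μ
  have h2 := (hxμ μ).2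
  rw [show (x + e μ) μ = x μ + 1 by simp [e_apply]] at h2
  rw [fold_of_mem hf (by linarith) (by linarith), fold_of_mem hf (by linarith) (by linarith)]; ring

omit hΦ in
/-- The step is `2M`-periodic. [folklore] -/
theorem step_add_period (x : Site d) (τ μ : Fin d) :
    f ((x + ((2 * M : ℕ) : ℤ) • e τ) μ + 1 - lo μ) - f ((x + ((2 * M : ℕ) : ℤ) • e τ) μ - lo μ) = f (x μ + 1 - lo μ) - f (x μ - lo μ) := by
  by_cases hi : μ = τ
  · subst hi
    rw [add_zsmul_e_apply_self, show x μ + ((2 * M : ℕ) : ℤ) + 1 - lo μ = (x μ + 1 - lo μ) + 2 * (M : ℤ) by push_cast; ring,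
      show x μ + ((2 * M : ℕ) : ℤ) - lo μ = (x μ - lo μ) + 2 * (M : ℤ) by push_cast; ring, fold_add_period hf, fold_add_period hf]
  · rw [add_zsmul_e_apply_ne x hi]

/-! ## §3 The pullback `Ã` of a box bond field along the fold -/

variable {E : Type*}

section AddGroup

variable [AddCommGroup E] {A Ã : Site d → Fin d → E}
  (hÃ : ∀ (x : Site d) (μ : Fin d), Ã x μ = if f (x μ + 1 - lo μ) - f (x μ - lo μ) = 1 then A (Φ x) μ
    else if f (x μ + 1 - lo μ) - f (x μ - lo μ) = -1 then -A (Φ x - e μ) μ else 0)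
include hÃ

/-- The pullback is `2M`-periodic in every direction. [folklore] -/
theorem pull_periodic (x : Site d) (τ μ : Fin d) : Ã (x + ((2 * M : ℕ) : ℤ) • e τ) μ = Ã x μ := by
  rw [hÃ, hÃ x, step_add_period hf, foldPt_add_period hf hΦ]

/-- On the bonds of the box the pullback is the field itself. [folklore] -/
theorem pull_eq_self {x : Site d} {μ : Fin d} (hx : ∀ i, lo i ≤ x i ∧ x i < lo i + M)
    (hxμ : ∀ i, lo i ≤ (x + e μ) i ∧ (x + e μ) i < lo i + M) : Ã x μ = A x μ := by
  rw [hÃ, step_of_mem hf hx hxμ, if_pos rfl, foldPt_of_mem hf hΦ hx]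

omit hΦ in
/-- **THE STRADDLING BONDS CARRY `0`**: at `x_μ = lo_μ + M − 1` (the bond crossing the top mirror) the pullback vanishes (`M ≥ 1`). [folklore] -/
theorem pull_face_eq_zero (hM : 1 ≤ M) {x : Site d} {μ : Fin d} (hx : x μ = lo μ + M - 1) : Ã x μ = 0 := by
  have hstep : f (x μ + 1 - lo μ) - f (x μ - lo μ) = 0 := by
    rw [show x μ + 1 - lo μ = (x μ - lo μ) + 1 by ring]
    have hc : x μ - lo μ = (M : ℤ) - 1 := by rw [hx]; ring
    have hM' : (1 : ℤ) ≤ M := by exact_mod_cast hM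
    have hr : (x μ - lo μ) % (2 * (M : ℤ)) = M - 1 := by rw [hc]; exact Int.emod_eq_of_lt (by linarith) (by linarith)
    rcases fold_step hf hM (x μ - lo μ) with ⟨h, -⟩ | ⟨-, h, -⟩ | ⟨h, -, -⟩ | ⟨h, -, -⟩
    · omega
    · rw [h]; ring
    · omega
    · omega
  rw [hÃ, hstep]; norm_num

omit hf hΦ in
/-- **THE PULLBACK COMMUTES WITH ODD BOND MAPS**: for `g` with `g 0 = 0`, `g(−a) = −g a`, the pullback of `g ∘ A` is `g ∘ Ã` bondwise. [folklore] -/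
theorem pull_map_odd {E' : Type*} [AddCommGroup E'] (g : E → E') (h0 : g 0 = 0) (hodd : ∀ a, g (-a) = -g a)
    {B : Site d → Fin d → E'}
    (hB : ∀ (x : Site d) (μ : Fin d), B x μ = if f (x μ + 1 - lo μ) - f (x μ - lo μ) = 1 then g (A (Φ x) μ)
      else if f (x μ + 1 - lo μ) - f (x μ - lo μ) = -1 then -g (A (Φ x - e μ) μ) else 0)
    (x : Site d) (μ : Fin d) : B x μ = g (Ã x μ) := by
  rw [hB, hÃ]
  split_ifs <;> simp [h0, hodd]

end AddGroup

section Normed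

variable [NormedAddCommGroup E] {A Ã : Site d → Fin d → E}
  (hÃ : ∀ (x : Site d) (μ : Fin d), Ã x μ = if f (x μ + 1 - lo μ) - f (x μ - lo μ) = 1 then A (Φ x) μ
    else if f (x μ + 1 - lo μ) - f (x μ - lo μ) = -1 then -A (Φ x - e μ) μ else 0)
include hÃ

/-- **THE PULLBACK IS BOUNDED BY THE BOX FIELD**: if `‖A‖ ≤ a` on the bonds of the box (`a ≥ 0`, `M ≥ 1`) then `‖Ã‖ ≤ a` everywhere. [folklore] -/
theorem norm_pull_le (hM : 1 ≤ M) {a : ℝ} (ha : 0 ≤ a)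
    (hA : ∀ (y : Site d) (κ : Fin d), (∀ i, lo i ≤ y i ∧ y i < lo i + M) → (∀ i, lo i ≤ (y + e κ) i ∧ (y + e κ) i < lo i + M) → ‖A y κ‖ ≤ a)
    (x : Site d) (μ : Fin d) : ‖Ã x μ‖ ≤ a := by
  have hy : ∀ i, lo i ≤ Φ x i ∧ Φ x i < lo i + M := foldPt_mem hf hΦ hM x
  have hyμ : ∀ i, lo i ≤ Φ (x + e μ) i ∧ Φ (x + e μ) i < lo i + M := foldPt_mem hf hΦ hM (x + e μ)
  rw [foldPt_add_e hΦ] at hyμ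
  rw [hÃ]
  split_ifs with h1 h2
  · rw [h1, one_smul] at hyμ; exact hA _ _ hy hyμ
  · rw [h2, neg_smul, one_smul, ← sub_eq_add_neg] at hyμ
    rw [norm_neg]; exact hA _ _ hyμ (by rw [sub_add_cancel]; exact hy)
  · rw [norm_zero]; exact ha

end Normed

end Fold

end Summit.QuantumFields.BalabanUV.T4Continuum.NE7BoxReflection
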